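import Literature.RingTheory.MvPolynomial.NoetherFormsToolkit
import Mathlib.RingTheory.Polynomial.Resultant.Basic
import Mathlib.RingTheory.MvPolynomial.Basic
import Mathlib.LinearAlgebra.Matrix.Adjugate
import HarnessLib

/-!
# Determinants, adjugates and the Sylvester adjoint: degree and norm bounds (tools)

Support file for the proof of Kaltofen's Theorem 7 (`kaltofen1995_thm7`; E. Kaltofen, *Effective
Noether irreducibility forms and applications*, J. Comput. System Sci. 50 (1995) 274–295), for
the bounds of his §3 on the objects of `KaltofenTestDefs`:

* determinants with ROW-dependent entry bounds (`totalDegree_det_le_sum_rows`,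
  `seminorm_det_le_rows`) — the maximal minors `Δ` of Kaltofen's matrix (29) have rows of very
  different sizes (row `k` grows like `k`), and the budget `deg Δ ≤ 12d⁶ − …` of Thm. 4 is met
  only with per-row bookkeeping;
* entries of the adjugate (`totalDegree_adjugate_le`, `seminorm_adjugate_le`) and the
  coefficients of the first component of Mathlib's `Polynomial.adjSylvester` applied to `1`
  (`coeff_adjSylvester_fst_one`) — this is Kaltofen's cofactor `t(z)` in `s f₀ + t f₀' = ρ`
  (eq. (12)), whose coefficients are signed maximal minors of the Sylvester matrix;
* the elementary "layer-cake" estimate `two_mul_sum_fst_le` for the sum of the row indices `k` of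
  `d·m` distinct cells of a `(ℓ+1) × d` board: `2 Σ k ≤ d·m·(2ℓ + 1 − m)`.

Everything here is [folklore]; no cited statements, no named facts.

## References

* E. Kaltofen, J. Comput. System Sci. 50 (1995) 274–295, §3 (12), Thms. 3, 4. [Kaltofen1995]
-/

noncomputable section

open Polynomial

namespace Literature.RingTheory.MvPolynomial.KaltofenBounds

open Literature.RingTheory.MvPolynomial.NoetherForms

universe u v

/-! ### Determinants with row-dependent bounds -/

section Det

variable {σ : Type u} {A : Type v} [CommRing A] {n : Type*} [Fintype n] [DecidableEq n]

/-- Integer constants have total degree `0`. [folklore] -/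
theorem totalDegree_intCast (k : ℤ) : ((k : MvPolynomial σ A)).totalDegree = 0 := by
  rw [← map_intCast (MvPolynomial.C : A →+* MvPolynomial σ A) k]
  exact MvPolynomial.totalDegree_C _

/-- If the entries of row `i` have total degree `≤ B i`, then `deg det ≤ Σ B i`. [folklore] -/
theorem totalDegree_det_le_sum_rows (M : Matrix n n (MvPolynomial σ A)) (B : n → ℕ)
    (hM : ∀ i j, (M i j).totalDegree ≤ B i) : M.det.totalDegree ≤ ∑ i, B i := by
  rw [Matrix.det_apply']
  refine (MvPolynomial.totalDegree_finsetSum _ _).trans (Finset.sup_le fun π _ => ?_)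
  refine (MvPolynomial.totalDegree_mul _ _).trans ?_
  rw [totalDegree_intCast, zero_add]
  refine (MvPolynomial.totalDegree_finsetProd _ _).trans ?_
  calc ∑ i, (M (π i) i).totalDegree ≤ ∑ i, B (π i) := Finset.sum_le_sum fun i _ => hM _ _
    _ = ∑ i, B i := Equiv.sum_comp π B

/-- Ring-seminorm version: if `q (M i j) ≤ B i` (row bounds, `B ≥ 0`, `q 1 ≤ 1`) then
`q (det M) ≤ |n|! ∏ B i`. [folklore] -/
theorem seminorm_det_le_rows {S : Type*} [CommRing S] (q : RingSeminorm S) (hq : q 1 ≤ 1)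
    (M : Matrix n n S) (B : n → ℝ) (hB : ∀ i, 0 ≤ B i) (hM : ∀ i j, q (M i j) ≤ B i) :
    q M.det ≤ (Fintype.card n).factorial * ∏ i, B i := by
  rw [← Matrix.det_transpose]
  exact seminorm_det_le q hq M.transpose B hB fun i j => hM j i

omit [Fintype n] in
/-- Entries of a row replaced by a coordinate vector have total degree `0`. [folklore] -/
theorem totalDegree_updateRow_single_le (M : Matrix n n (MvPolynomial σ A)) (B : ℕ)
    (hM : ∀ i j, (M i j).totalDegree ≤ B) (i j r c : n) :
    (M.updateRow j (Pi.single i 1) r c).totalDegree ≤ if r = j then 0 else B := by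
  rw [Matrix.updateRow_apply]
  split_ifs with h
  · rw [Pi.single_apply]
    split_ifs
    · rw [MvPolynomial.totalDegree_one]
    · rw [MvPolynomial.totalDegree_zero]
  · exact hM r c

/-- Adjugate entries: `deg (adj M)ᵢⱼ ≤ (|n| − 1)·B` if all entries have degree `≤ B`. [folklore] -/
theorem totalDegree_adjugate_le (M : Matrix n n (MvPolynomial σ A)) (B : ℕ)
    (hM : ∀ i j, (M i j).totalDegree ≤ B) (i j : n) :
    (M.adjugate i j).totalDegree ≤ (Fintype.card n - 1) * B := by
  rw [Matrix.adjugate_apply]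
  refine (totalDegree_det_le_sum_rows _ (fun r => if r = j then 0 else B)
    (totalDegree_updateRow_single_le M B hM i j)).trans ?_
  rw [Finset.sum_ite, Finset.sum_const_zero, zero_add, Finset.sum_const, smul_eq_mul]
  refine Nat.mul_le_mul_right B ?_
  have : (Finset.univ.filter fun r : n => ¬r = j) = Finset.univ.erase j := by
    ext r; simp [Finset.mem_erase]
  rw [this, Finset.card_erase_of_mem (Finset.mem_univ j), Finset.card_univ]

omit [Fintype n] in
/-- Entries of a row replaced by a coordinate vector have seminorm `≤ 1` (if `q 1 ≤ 1`). [folklore] -/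
theorem seminorm_updateRow_single_le {S : Type*} [CommRing S] (q : RingSeminorm S) (hq : q 1 ≤ 1)
    (M : Matrix n n S) (B : ℝ) (hM : ∀ i j, q (M i j) ≤ B) (i j r c : n) :
    q (M.updateRow j (Pi.single i 1) r c) ≤ if r = j then 1 else B := by
  rw [Matrix.updateRow_apply]
  split_ifs with h
  · rw [Pi.single_apply]
    split_ifs
    · exact hq
    · rw [map_zero]; exact zero_le_one
  · exact hM r c

/-- Adjugate entries: `q (adj M)ᵢⱼ ≤ |n|! · B^{|n|−1}` if `q (M i j) ≤ B`, `B ≥ 0`, `q 1 ≤ 1`.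
[folklore] -/
theorem seminorm_adjugate_le {S : Type*} [CommRing S] (q : RingSeminorm S) (hq : q 1 ≤ 1)
    (M : Matrix n n S) (B : ℝ) (hB : 0 ≤ B) (hM : ∀ i j, q (M i j) ≤ B) (i j : n) :
    q (M.adjugate i j) ≤ (Fintype.card n).factorial * B ^ (Fintype.card n - 1) := by
  rw [Matrix.adjugate_apply]
  refine (seminorm_det_le_rows q hq _ (fun r => if r = j then 1 else B)
    (fun r => by split_ifs; exacts [zero_le_one, hB]) (seminorm_updateRow_single_le q hq M B hM i j)).trans ?_
  refine mul_le_mul_of_nonneg_left (le_of_eq ?_) (Nat.cast_nonneg _)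
  rw [Finset.prod_ite, Finset.prod_const_one, one_mul, Finset.prod_const]
  congr 1
  have : (Finset.univ.filter fun r : n => ¬r = j) = Finset.univ.erase j := by
    ext r; simp [Finset.mem_erase]
  rw [this, Finset.card_erase_of_mem (Finset.mem_univ j), Finset.card_univ]

end Det

/-! ### The first component of `adjSylvester` applied to `1` -/

section Sylvester

variable {R : Type u} [CommRing R]

/-- `1 ∈ R[X]_{m+n}` is the basis vector `X⁰`. [folklore] -/
theorem one_eq_degreeLT_basis {m n : ℕ} (h : (1 : R[X]) ∈ degreeLT R (m + n)) (h0 : 0 < m + n) :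
    (⟨1, h⟩ : degreeLT R (m + n)) = degreeLT.basis R (m + n) ⟨0, h0⟩ := by
  apply Subtype.ext
  rw [degreeLT.basis_val, pow_zero]

/-- The coefficients of Kaltofen's cofactor: the `zʲ`-coefficient of the first component of
`adjSylvester f g 1` is the adjugate entry `(adj Syl(f,g))_{j,0}` for `j < m` and `0` otherwise.
[folklore] -/
theorem coeff_adjSylvester_fst_one (f g : R[X]) {m n : ℕ} (h : (1 : R[X]) ∈ degreeLT R (m + n))
    (h0 : 0 < m + n) (j : ℕ) :
    ((adjSylvester f g (m := m) (n := n) ⟨1, h⟩).1 : R[X]).coeff j =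
      if hj : j < m then (sylvester f g m n).adjugate (Fin.castAdd n ⟨j, hj⟩) ⟨0, h0⟩ else 0 := by
  rw [one_eq_degreeLT_basis h h0, adjSylvester, Matrix.toLin_self]
  change ((∑ k, (sylvester f g m n).adjugate k ⟨0, h0⟩ • degreeLT.basisProd R m n k).1 : R[X]).coeff j = _
  rw [Prod.fst_sum, Fin.sum_univ_add]
  simp only [Prod.smul_fst, degreeLT.basisProd_castAdd, degreeLT.basisProd_natAdd, smul_zero,
    Finset.sum_const_zero, add_zero]
  rw [Submodule.coe_sum, Polynomial.finsetSum_coeff]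
  simp only [Submodule.coe_smul, degreeLT.basis_val, Polynomial.coeff_smul, Polynomial.coeff_X_pow,
    smul_eq_mul, mul_ite, mul_one, mul_zero]
  split_ifs with hj
  · rw [Finset.sum_eq_single ⟨j, hj⟩]
    · simp
    · intro b _ hb
      rw [if_neg]
      intro hjb
      exact hb (Fin.ext hjb.symm)
    · intro hn; exact absurd (Finset.mem_univ _) hn
  · refine Finset.sum_eq_zero fun b _ => ?_
    rw [if_neg]
    intro hjb
    exact hj (hjb ▸ b.is_lt)

/-- A predicate true of `0` and of all coefficients of `f` and `g` holds for every entry of the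
Sylvester matrix. [folklore] -/
theorem forall_sylvester' {S : Type*} [Semiring S] (P : S → Prop) (h0 : P 0) (f g : S[X]) (m k : ℕ)
    (hf : ∀ i, P (f.coeff i)) (hg : ∀ i, P (g.coeff i)) : ∀ i j, P (sylvester f g m k i j) := by
  intro i j
  rw [sylvester, Matrix.of_apply]
  refine Fin.addCases (fun j₁ => ?_) (fun j₁ => ?_) j
  · rw [Fin.addCases_left]
    split_ifs
    · exact hg _
    · exact h0
  · rw [Fin.addCases_right]
    split_ifs
    · exact hf _
    · exact h0

/-- Degree of the coefficients of Kaltofen's cofactor `t(z)`: if all coefficients of `f, g` have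
total degree `≤ B`, those of `(adjSylvester f g 1).1` have total degree `≤ (m + n − 1)·B`.
[cite: Kaltofen1995, §3 (12)–(13)] -/
theorem totalDegree_coeff_adjSylvester_fst_one_le {σ : Type*} {A : Type*} [CommRing A]
    (f g : (MvPolynomial σ A)[X]) {m n : ℕ} (h : (1 : (MvPolynomial σ A)[X]) ∈ degreeLT _ (m + n))
    (h0 : 0 < m + n) (B : ℕ) (hf : ∀ i, (f.coeff i).totalDegree ≤ B) (hg : ∀ i, (g.coeff i).totalDegree ≤ B)
    (j : ℕ) :
    (((adjSylvester f g (m := m) (n := n) ⟨1, h⟩).1 : (MvPolynomial σ A)[X]).coeff j).totalDegree ≤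
      (m + n - 1) * B := by
  rw [coeff_adjSylvester_fst_one f g h h0]
  split_ifs with hj
  · refine (totalDegree_adjugate_le _ B ?_ _ _).trans (by rw [Fintype.card_fin])
    exact forall_sylvester' (fun x => x.totalDegree ≤ B) (by rw [MvPolynomial.totalDegree_zero]; exact Nat.zero_le _)
      f g m n hf hg
  · rw [MvPolynomial.totalDegree_zero]; exact Nat.zero_le _

/-- Norm of the coefficients of Kaltofen's cofactor `t(z)`: if `q ≤ B` on all coefficients of
`f, g` (`B ≥ 0`, `q 1 ≤ 1`), then `q ≤ (m+n)! B^{m+n−1}` on the coefficients of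
`(adjSylvester f g 1).1`. [cite: Kaltofen1995, §3 (12)–(13), Thm. 3] -/
theorem seminorm_coeff_adjSylvester_fst_one_le (q : RingSeminorm R) (hq : q 1 ≤ 1)
    (f g : R[X]) {m n : ℕ} (h : (1 : R[X]) ∈ degreeLT R (m + n)) (h0 : 0 < m + n) (B : ℝ) (hB : 0 ≤ B)
    (hf : ∀ i, q (f.coeff i) ≤ B) (hg : ∀ i, q (g.coeff i) ≤ B) (j : ℕ) :
    q (((adjSylvester f g (m := m) (n := n) ⟨1, h⟩).1 : R[X]).coeff j) ≤
      (m + n).factorial * B ^ (m + n - 1) := by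
  rw [coeff_adjSylvester_fst_one f g h h0]
  split_ifs with hj
  · have := seminorm_adjugate_le q hq (sylvester f g m n) B hB
      (forall_sylvester' (fun x => q x ≤ B) (by rw [map_zero]; exact hB) f g m n hf hg)
      (Fin.castAdd n ⟨j, hj⟩) ⟨0, h0⟩
    rwa [Fintype.card_fin] at this
  · rw [map_zero]; positivity

end Sylvester

/-! ### The layer-cake estimate for sums of row indices -/

section LayerCake

/-- `2 Σ_{j<ℓ} min(m, j+1) + min(m,ℓ)² = min(m,ℓ)·(2ℓ+1)`. [folklore] -/
theorem two_mul_sum_min_add (m ℓ : ℕ) :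
    2 * (∑ j ∈ Finset.range ℓ, min m (j + 1)) + min m ℓ * min m ℓ = min m ℓ * (2 * ℓ + 1) := by
  induction ℓ with
  | zero => simp
  | succ ℓ ih =>
    rw [Finset.sum_range_succ, mul_add]
    rcases le_or_gt m ℓ with hm | hm
    · have h1 : min m ℓ = m := min_eq_left hm
      have h2 : min m (ℓ + 1) = m := min_eq_left (by omega)
      rw [h1] at ih
      rw [h2]
      nlinarith [ih]
    · have h1 : min m ℓ = ℓ := min_eq_right hm.le
      have h2 : min m (ℓ + 1) = ℓ + 1 := min_eq_right (by omega)
      rw [h1] at ih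
      rw [h2]
      nlinarith [ih]

/-- A natural number `k ≤ ℓ` counts the `s < ℓ` below it. [folklore] -/
theorem eq_card_filter_lt (k ℓ : ℕ) (hk : k ≤ ℓ) :
    k = ((Finset.range ℓ).filter fun s => s < k).card := by
  have : (Finset.range ℓ).filter (fun s => s < k) = Finset.range k := by
    ext s
    simp only [Finset.mem_filter, Finset.mem_range]
    omega
  rw [this, Finset.card_range]

/-- **Layer-cake estimate.** For an injective map `S` from a set of `d·m` cells into the board
`{0,…,ℓ} × {0,…,d−1}` (`m ≤ ℓ`), twice the sum of the row indices is at most `d·m·(2ℓ+1−m)`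
(attained by filling the top `m` rows). [folklore] -/
theorem two_mul_sum_fst_le {ℓ d m : ℕ} {C : Type*} [Fintype C] (S : C → Fin (ℓ + 1) × Fin d)
    (hS : Function.Injective S) (hC : Fintype.card C = d * m) (hm : m ≤ ℓ) :
    2 * ∑ c, ((S c).1 : ℕ) ≤ d * m * (2 * ℓ + 1 - m) := by
  classical
  -- layer cake: `k = #{s < ℓ : s < k}`
  have hk : ∀ c, ((S c).1 : ℕ) = ∑ s ∈ Finset.range ℓ, if s < ((S c).1 : ℕ) then 1 else 0 := by
    intro c
    rw [Finset.sum_boole, Nat.cast_id]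
    exact eq_card_filter_lt _ _ (Nat.lt_succ_iff.1 (S c).1.is_lt)
  have hswap : ∑ c, ((S c).1 : ℕ) =
      ∑ s ∈ Finset.range ℓ, (Finset.univ.filter fun c : C => s < ((S c).1 : ℕ)).card := by
    rw [Finset.sum_congr rfl fun c _ => hk c, Finset.sum_comm]
    refine Finset.sum_congr rfl fun s _ => ?_
    rw [Finset.sum_boole, Nat.cast_id]
  -- each layer has at most `min (d m) (d (ℓ - s))` cells
  have hlayer : ∀ s ∈ Finset.range ℓ,
      (Finset.univ.filter fun c : C => s < ((S c).1 : ℕ)).card ≤ d * min m (ℓ - s) := by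
    intro s hs
    have h1 : (Finset.univ.filter fun c : C => s < ((S c).1 : ℕ)).card ≤ d * m := by
      rw [← hC]; exact Finset.card_filter_le _ _
    have h2 : (Finset.univ.filter fun c : C => s < ((S c).1 : ℕ)).card ≤ d * (ℓ - s) := by
      have hinj : Set.InjOn (fun c : C => (((S c).1 : ℕ), ((S c).2 : ℕ)))
          ↑(Finset.univ.filter fun c : C => s < ((S c).1 : ℕ)) := by
        intro c₁ _ c₂ _ hc
        simp only [Prod.mk.injEq] at hc
        apply hS
        exact Prod.ext (Fin.ext hc.1) (Fin.ext hc.2)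
      have hmaps : ∀ c ∈ Finset.univ.filter (fun c : C => s < ((S c).1 : ℕ)),
          (fun c : C => (((S c).1 : ℕ), ((S c).2 : ℕ))) c ∈ Finset.Ioc s ℓ ×ˢ Finset.range d := by
        intro c hc
        simp only [Finset.mem_filter, Finset.mem_univ, true_and] at hc
        simp only [Finset.mem_product, Finset.mem_Ioc, Finset.mem_range]
        exact ⟨⟨hc, Nat.lt_succ_iff.1 (S c).1.is_lt⟩, (S c).2.is_lt⟩
      have := Finset.card_le_card_of_injOn _ hmaps hinj
      rw [Finset.card_product, Nat.card_Ioc, Finset.card_range] at this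
      rwa [mul_comm] at this
    rcases le_total m (ℓ - s) with h | h
    · rw [min_eq_left h]; exact h1
    · rw [min_eq_right h]; exact h2
  have hsum : ∑ c, ((S c).1 : ℕ) ≤ d * ∑ s ∈ Finset.range ℓ, min m (ℓ - s) := by
    rw [hswap, Finset.mul_sum]
    exact Finset.sum_le_sum hlayer
  -- reflect and evaluate
  have hrefl : ∑ s ∈ Finset.range ℓ, min m (ℓ - s) = ∑ j ∈ Finset.range ℓ, min m (j + 1) := by
    rw [← Finset.sum_range_reflect (fun j => min m (j + 1)) ℓ]
    refine Finset.sum_congr rfl fun s hs => ?_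
    rw [Finset.mem_range] at hs
    congr 1
    omega
  have heval := two_mul_sum_min_add m ℓ
  rw [min_eq_left hm] at heval
  have hfin : 2 * (∑ j ∈ Finset.range ℓ, min m (j + 1)) = m * (2 * ℓ + 1 - m) := by
    have hml : m ≤ 2 * ℓ + 1 := by omega
    zify [hml] at heval ⊢
    linear_combination heval
  calc 2 * ∑ c, ((S c).1 : ℕ) ≤ 2 * (d * ∑ s ∈ Finset.range ℓ, min m (ℓ - s)) :=
        Nat.mul_le_mul_left 2 hsum
    _ = d * (2 * ∑ j ∈ Finset.range ℓ, min m (j + 1)) := by rw [hrefl]; ring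
    _ = d * m * (2 * ℓ + 1 - m) := by rw [hfin, mul_assoc]

end LayerCake

end Literature.RingTheory.MvPolynomial.KaltofenBounds

end
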